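/-
Copyright (c) 2026 the pub-hodgecm-mathlib formalisation cell (harness21).  Prover seat hodgecm-mathlib-K2E3-p17 (g10), HCML Track B «K2-LIT» ∕ h413
(`stmt-HodgeConjecture-24833`), R90-TF section S3 hand S3-p15 (J1 σ-dictionary), helper brick (J1′a) «the H-side split Levi isomorphism»
(census 2026-09-04T22:46Z; dealer R90-C12-plan (g0) DEAL S3-p15 22:42:23Z).  2026-09-04.
-/
import Literature.NumberTheory.Automorphic.UnitaryGroupConstantTermSplit                 -- ★ `cmSplitEquivTwo ∕ One`, `cmSplitLeviGL`, `lastBlockLabel_three_eq`, `cmSplitLeviGL_mem_standardParabolicGL`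
import Literature.NumberTheory.Automorphic.GLnStandardLeviTwoBlockModel                   -- ★ `exists_continuousMulEquiv_prod_standardLeviGL_twoBlock`
import Summits.HodgeConjecture.HodgeConjecture.Theorems.K2E3ParabolicCharacterLeviUnipotentGL  -- ★ `exists_homeomorph_leviProjection_inclusion` (`M_c ≃ₜ Π_a GL_{n_a}` by `proj ∘ incl`)
import HarnessLib

/-!
# R90 · S3 · (J1′a) — THE `H`-SIDE SPLIT LEVI ISOMORPHISMS of topological groups:
# `H_v ≃ₜ* M_{(2,1)}(L_w)` (coe = ★ `cmSplitLeviGL`) and `M_c ≃ₜ* Π_a GL_{n_a}(F)` (= `proj ∘ incl`), hence `H_v ≃ₜ* (block Levi of GL₃(L_w))`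

R90-TF section S3 (dealer R90-C12-plan (g0)), seat K2E3-p17 (g10); helper brick (J1′a) of hand S3-p15 (the σ-side dictionary `hJ1` of the junction ★
`print_4131b_vanDijkSplit_of`, p862576 :108), named in the S3-p15 census (2026-09-04T22:46Z) as the one piece of the H-side not ★ AS AN EQUIVALENCE.  Crux H413 =
`stmt-HodgeConjecture-24833` (lane `--kind proof --supports … --as helper`).  THEOREMS ONLY (no `def`, no instance, no notation, no named fact, no `sorry`); ★ imports only.

THE MATHEMATICS [Rogawski1990, §4.13 p. 64]: at a place `v` of `L⁺` split in `L` and `w ∣ v`, `H_v = U(Φ₂)(L⁺_v) × U(Φ₁)(L⁺_v) ≅ GL₂(L_w) × GL₁(L_w)` (★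
`cmSplitEquivTwo`, `cmSplitEquivOne` = ★ `localSplitEquiv`), and `GL₂ × GL₁` IS the standard Levi `M_{(2,1)} ≤ GL₃` [BernsteinZelevinsky1977, §2.1] (★
`exists_continuousMulEquiv_prod_standardLeviGL_twoBlock` at `(k,l) = (2,1)`, labelling `i ↦ [2 ≤ i]` = ★ `Zelevinsky1980.lastBlockLabel 3` by ★ `lastBlockLabel_three_eq`).
The tree names the composite only as a MONOID HOM ★ `cmSplitLeviHom` (`= codRestrict cmSplitLeviGL`); this file packages it as an isomorphism of topological groups,
and also upgrades ★ `exists_homeomorph_leviProjection_inclusion` (`M_c ≃ₜ Π_a GL_{n_a}(F)`) to a `≃ₜ*`.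
* §1 `exists_continuousMulEquiv_standardLeviGL_of_eq` — transport of a `≃ₜ*` onto `M_c` along an equality of labellings `c = c′` (by `subst`).
* §2 `exists_splitLeviContinuousMulEquiv` — `∃ ι : H_v ≃ₜ* M_{(2,1)}(L_w), ∀ h, (ι h : GL₃(L_w)) = cmSplitLeviGL L v w hw h`.
* §3 `exists_continuousMulEquiv_leviProjection_inclusion` — `∃ θ : M_c ≃ₜ* Π_a GL_{n_a}(F), ∀ m, θ m = proj (incl m)` (any local field `F`, any labelling `c`).
* §4 `exists_splitBlockLeviContinuousMulEquiv` — `∃ Θ : H_v ≃ₜ* Π_a GL {i ∕∕ c₃ i = a} L_w, ∀ h, Θ h = proj ⟨cmSplitLeviGL h, _⟩` (the frame in which the junction's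
  `σ′ ∘ (proj ∘ incl)` is read on `H_v`).
HONEST LABEL: group-isomorphism plumbing — proves nothing printed; HC_CM is proved only modulo the 7 printed citations (2 remaining named inputs: hLiu418 =
stmt-HodgeConjecture-24832, h413 = stmt-HodgeConjecture-24833) until rung 0 closes; count-neutral.

References: [Rogawski1990] §4.13 p. 64; [BernsteinZelevinsky1977] §2.1; [PlatonovRapinchuk1994] §2.3.
-/

set_option autoImplicit false
-- the mandated namespace repeats the single-problem summit's segment (`HodgeConjecture.HodgeConjecture`)
set_option linter.dupNamespace false

noncomputable section

namespace Summit.HodgeConjecture.HodgeConjecture.R90.S3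

open NumberField IsDedekindDomain
open Literature.NumberTheory Literature.NumberTheory.Automorphic Literature.NumberTheory.Automorphic.UnitaryGroup
open Literature.NumberTheory.GaloisRepresentations
open scoped Matrix MatrixGroups

/-! ## §1 Transport of a topological-group isomorphism onto `M_c` along an equality of labellings -/

/-- An isomorphism of topological groups onto `M_c` yields one onto `M_{c′}` with the same underlying matrices whenever `c = c′` (`subst`).
[cite: BernsteinZelevinsky1977, §2.1] -/
theorem exists_continuousMulEquiv_standardLeviGL_of_eq {S : Type*} [CommRing S] [TopologicalSpace S] [IsTopologicalRing S]
    {n : Type*} [Fintype n] [DecidableEq n] {α : Type*} [LinearOrder α] [Fintype α] {c c' : n → α} (h : c = c')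
    {A : Type*} [Group A] [TopologicalSpace A] (E : A ≃ₜ* ↥(standardLeviGL S c)) :
    ∃ E' : A ≃ₜ* ↥(standardLeviGL S c'), ∀ x, ((E' x : ↥(standardLeviGL S c')) : GL n S) = ((E x : ↥(standardLeviGL S c)) : GL n S) := by
  subst h
  exact ⟨E, fun _ => rfl⟩

/-! ## §2 `H_v ≃ₜ* M_{(2,1)}(L_w)` with underlying matrices ★ `cmSplitLeviGL` -/

section Split

variable (L : Type) [Field L] [NumberField L] [IsCMField L]
  (v : HeightOneSpectrum (𝓞 ↥(maximalRealSubfield L))) (w : PlacesOver L v) (hw : IsCMField.complexConj L • w.1 ≠ w.1)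

/-- **(J1′a) — the `H`-side split Levi isomorphism.**  At `w ∣ v` with `c • w ≠ w` there is an isomorphism of topological groups
`ι : H_v = U(Φ₂)(L⁺_v) × U(Φ₁)(L⁺_v) ≃ₜ* M_{(2,1)}(L_w)` (`= standardLeviGL L_w (lastBlockLabel 3)`) whose underlying matrix is `diag(e₂ h.1, e₁ h.2)` = ★
`cmSplitLeviGL L v w hw h` (so `ι` refines ★ `cmSplitLeviHom` to an equivalence): `(e₂ × e₁)` (★ `cmSplitEquivTwo ∕ One`) followed by the two-block Levi model ★
`exists_continuousMulEquiv_prod_standardLeviGL_twoBlock` (labelling transported by ★ `lastBlockLabel_three_eq`, §1).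
[cite: Rogawski1990, §4.13 p. 64] [cite: BernsteinZelevinsky1977, §2.1] -/
theorem exists_splitLeviContinuousMulEquiv :
    ∃ ι : ((cmDatum L 2 (Matrix.of fun i j : Fin 2 => if i.val + j.val + 1 = 2 then (1 : L) else 0)).Local v ×
        (cmDatum L 1 (Matrix.of fun i j : Fin 1 => if i.val + j.val + 1 = 1 then (1 : L) else 0)).Local v) ≃ₜ*
        ↥(standardLeviGL (w.1.adicCompletion L) (Zelevinsky1980.lastBlockLabel 3)),
      ∀ h, ((ι h : ↥(standardLeviGL (w.1.adicCompletion L) (Zelevinsky1980.lastBlockLabel 3))) : GL (Fin 3) (w.1.adicCompletion L)) =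
        cmSplitLeviGL L v w hw h := by
  haveI : IsTopologicalRing (w.1.adicCompletion L) := inferInstance
  -- the two-block Levi model at the labelling `i ↦ [2 ≤ i]`, transported to `lastBlockLabel 3`
  obtain ⟨E0, hE0⟩ := exists_continuousMulEquiv_prod_standardLeviGL_twoBlock (S := w.1.adicCompletion L) (k := 2) (l := 1)
  obtain ⟨E, hE⟩ := exists_continuousMulEquiv_standardLeviGL_of_eq (lastBlockLabel_three_eq).symm E0
  -- compose with `e₂ × e₁`
  refine ⟨{ toFun := fun h => E (cmSplitEquivTwo L v w hw h.1, cmSplitEquivOne L v w hw h.2)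
            invFun := fun m => ((cmSplitEquivTwo L v w hw).symm (E.symm m).1, (cmSplitEquivOne L v w hw).symm (E.symm m).2)
            left_inv := fun h => ?_
            right_inv := fun m => ?_
            map_mul' := fun h h' => ?_
            continuous_toFun := ?_
            continuous_invFun := ?_ }, fun h => ?_⟩
  · simp only [ContinuousMulEquiv.symm_apply_apply, Prod.mk.eta]
  · simp only [ContinuousMulEquiv.apply_symm_apply, Prod.mk.eta]
  · rw [Prod.fst_mul, Prod.snd_mul, map_mul, map_mul, ← Prod.mk_mul_mk, map_mul]
  · exact E.continuous.comp (((cmSplitEquivTwo L v w hw).continuous.comp continuous_fst).prodMk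
      ((cmSplitEquivOne L v w hw).continuous.comp continuous_snd))
  · exact ((cmSplitEquivTwo L v w hw).symm.continuous.comp (continuous_fst.comp E.symm.continuous)).prodMk
      ((cmSplitEquivOne L v w hw).symm.continuous.comp (continuous_snd.comp E.symm.continuous))
  · show ((E (cmSplitEquivTwo L v w hw h.1, cmSplitEquivOne L v w hw h.2) : ↥(standardLeviGL _ _)) : GL (Fin 3) (w.1.adicCompletion L)) = _
    rw [hE, hE0, cmSplitLeviGL_apply]

end Split

/-! ## §3 `M_c ≃ₜ* Π_a GL_{n_a}(F)` by `proj ∘ incl` -/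

section Blocks

variable (F : Type) [Field F] [ValuativeRel F] [TopologicalSpace F] [IsNonarchimedeanLocalField F]
  {n : ℕ} {α : Type*} [LinearOrder α] [Fintype α] (c : Fin n → α)

/-- **`θ : M_c ≃ₜ* Π_a GL_{n_a}(F)`, `θ m = proj (incl m)`** — ★ `exists_homeomorph_leviProjection_inclusion` (a homeomorphism with this underlying map) upgraded
to an isomorphism of topological GROUPS (the map is the monoid hom `leviProjection ∘ inclusion`). [cite: BernsteinZelevinsky1977, §2.1] -/
theorem exists_continuousMulEquiv_leviProjection_inclusion :
    ∃ θ : ↥(standardLeviGL F c) ≃ₜ* (Π a, GL {i // c i = a} F),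
      ∀ m, θ m = leviProjection F c (Subgroup.inclusion (standardLeviGL_le F c) m) := by
  obtain ⟨e, he⟩ := Summit.HodgeConjecture.HodgeConjecture.Cruxes.H413.K2E3ParabolicCharacterLeviUnipotentGL.exists_homeomorph_leviProjection_inclusion F c
  refine ⟨{ toFun := e
            invFun := e.symm
            left_inv := e.symm_apply_apply
            right_inv := e.apply_symm_apply
            map_mul' := fun x y => ?_
            continuous_toFun := e.continuous
            continuous_invFun := e.symm.continuous }, fun m => he m⟩
  rw [he, he, he, map_mul, map_mul]

end Blocks

/-! ## §4 `H_v ≃ₜ* (block Levi of GL₃(L_w))`, the frame of the junction's `σ′ ∘ (proj ∘ incl)` -/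

section SplitBlocks

variable (L : Type) [Field L] [NumberField L] [IsCMField L]
  (v : HeightOneSpectrum (𝓞 ↥(maximalRealSubfield L))) (w : PlacesOver L v) (hw : IsCMField.complexConj L • w.1 ≠ w.1)

/-- **`Θ : H_v ≃ₜ* Π_a GL {i ∕∕ lastBlockLabel 3 i = a} (L_w)`, `Θ h = proj ⟨cmSplitLeviGL h, _⟩`** — §2 followed by §3; the value at `h` is the block tuple of
`diag(e₂ h.1, e₁ h.2)`. [cite: Rogawski1990, §4.13 p. 64] [cite: BernsteinZelevinsky1977, §2.1] -/
theorem exists_splitBlockLeviContinuousMulEquiv :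
    ∃ Θ : ((cmDatum L 2 (Matrix.of fun i j : Fin 2 => if i.val + j.val + 1 = 2 then (1 : L) else 0)).Local v ×
        (cmDatum L 1 (Matrix.of fun i j : Fin 1 => if i.val + j.val + 1 = 1 then (1 : L) else 0)).Local v) ≃ₜ*
        (Π a, GL {i : Fin 3 // Zelevinsky1980.lastBlockLabel 3 i = a} (w.1.adicCompletion L)),
      (∀ h, Θ h = leviProjection (w.1.adicCompletion L) (Zelevinsky1980.lastBlockLabel 3)
          ⟨cmSplitLeviGL L v w hw h, cmSplitLeviGL_mem_standardParabolicGL L v w hw h⟩) ∧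
      ∃ ι : ((cmDatum L 2 (Matrix.of fun i j : Fin 2 => if i.val + j.val + 1 = 2 then (1 : L) else 0)).Local v ×
          (cmDatum L 1 (Matrix.of fun i j : Fin 1 => if i.val + j.val + 1 = 1 then (1 : L) else 0)).Local v) ≃ₜ*
          ↥(standardLeviGL (w.1.adicCompletion L) (Zelevinsky1980.lastBlockLabel 3)),
        (∀ h, ((ι h : ↥(standardLeviGL (w.1.adicCompletion L) (Zelevinsky1980.lastBlockLabel 3))) : GL (Fin 3) (w.1.adicCompletion L)) =
          cmSplitLeviGL L v w hw h) ∧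
        ∀ h, Θ h = leviProjection (w.1.adicCompletion L) (Zelevinsky1980.lastBlockLabel 3)
          (Subgroup.inclusion (standardLeviGL_le (w.1.adicCompletion L) (Zelevinsky1980.lastBlockLabel 3)) (ι h)) := by
  obtain ⟨ι, hι⟩ := exists_splitLeviContinuousMulEquiv L v w hw
  obtain ⟨θ, hθ⟩ := exists_continuousMulEquiv_leviProjection_inclusion (w.1.adicCompletion L) (Zelevinsky1980.lastBlockLabel 3)
  have hincl : ∀ h, Subgroup.inclusion (standardLeviGL_le (w.1.adicCompletion L) (Zelevinsky1980.lastBlockLabel 3)) (ι h) =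
      ⟨cmSplitLeviGL L v w hw h, cmSplitLeviGL_mem_standardParabolicGL L v w hw h⟩ := fun h =>
    Subtype.ext (by rw [Subgroup.coe_inclusion, hι])
  refine ⟨ι.trans θ, fun h => ?_, ι, hι, fun h => ?_⟩
  · rw [ContinuousMulEquiv.trans_apply, hθ, hincl]
  · rw [ContinuousMulEquiv.trans_apply, hθ]

end SplitBlocks

end Summit.HodgeConjecture.HodgeConjecture.R90.S3

end
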